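import Summits.BirchSwinnertonDyer.Rank1Residual.X1.CharIdealSquarePresentation
import Literature.RingTheory.FittingIdeal.Annihilator
import Mathlib.RingTheory.Norm.Transitivity
import Mathlib.LinearAlgebra.Dimension.Free
import HarnessLib

/-!
# `char` of the cokernel of an endomorphism, under restriction of scalars, and along a
# semilinear bijection

B2B cell `bsd-rank1-residual`, unit `eisenstein-p1` GEN 18, FILE 14 (X1R0-GAPMAP §27;
`V76-LOCAL-TERM-PLAN.md` §3.1 = (M3-n), V87). HONEST FRAMING: research route; THEOREMS ONLY (no
`def`, no named fact); generic commutative algebra, nothing about any curve; nothing booked.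

This is the ring-independent half of LEMMA M AT LAYER `n` ("`char` of the restriction of scalars
is the norm of `char`"). For the layer-`n` subalgebra `Λ_n ⊂ Λ` (FILE 13 `X1/LayerAlgebra`) it is
applied with `R = Λ_n ≅ Λ`, `S = Λ`, `σ : T ↦ ω_n`.

* §1 (any commutative ring `R`, `F` finite free, `e : F →ₗ F`): **`Fitt₀(F/e(F)) = (det e)`**
  (a square presentation by the matrix of `e`; the tree's Stacks-07Z6 lemma), `det e` kills
  `F/e(F)`, and over a Noetherian UFD with `det e ≠ 0`: **`char(F/e(F)) = (det e)`** (FILE 12).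
* §2 (a finite free extension `R → S`, `F` finite free over `S`, `e` `S`-linear): restricting
  scalars, **`char_R(F/e(F)) = (N_{S/R}(det_S e))`** — Mathlib's `LinearMap.det_restrictScalars`
  (`det_R e = N_{S/R}(det_S e)`).
* §3 (a ring map `σ : R →+* S`, a `σ`-SEMILINEAR bijection `ψ : C → X` from an `R`-module onto an
  `S`-module): if `S = ∑_i σ(R)·s_i` is finitely generated over `σ(R)`, then **`C` has no non-zero
  finite `R`-submodule when `X` has no non-zero finite `S`-submodule**
  (`eq_bot_of_finite_of_semilinear`), and **`#(C/IC) = #(X/σ(I)X)`** for every ideal `I ≤ R`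
  (`natCard_quotient_eq_of_semilinear`). These transport the hypotheses of LEMMA M (FILE 11) from
  `X` to its layer-`n` twist `C`.

## Sources
* The Stacks Project, Tag 07Z6; D. Eisenbud, GTM 150, §20.2 (Fitting ideal of a square
  presentation) — tree `Literature/RingTheory/FittingIdeal/`.
* C. Skinner, E. Urban, Invent. Math. 195 (2014), §3.1.6 (`Fitt₀` vs `char`) — tree.
* N. Bourbaki, *Algebra* III §9.4 (norm and determinant in a tower) — Mathlib
  `LinearMap.det_restrictScalars`.
* L. Washington, GTM 83, §13.2 (restriction to `Λ_n = ℤ_p⟦ω_n⟧`). [Washington1997]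
-/

namespace Summit.BirchSwinnertonDyer.Rank1Residual.X1.CharIdealRestrictScalars

open Literature.RingTheory.FittingIdeal Literature.NumberTheory.EllipticCurves

open scoped Matrix

universe u v w

/-! ## §1. The cokernel of an endomorphism of a finite free module -/

section Coker

variable {R : Type u} [CommRing R] {F : Type v} [AddCommGroup F] [Module R F]
  [Module.Free R F] [Module.Finite R F] (e : F →ₗ[R] F)

/-- **`Fitt₀(F / e(F)) = (det e)`** for an endomorphism `e` of a finite free module `F`: the
images of a basis `b` generate `F/e(F)`, the rows of the (transposed) matrix of `e` are relations,
and they generate all relations (coordinates in `b`). [cite: StacksProject, Tag 07Z6] -/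
theorem fittingIdeal_zero_quotient_range_eq_span_det :
    Module.fittingIdeal R (F ⧸ LinearMap.range e) 0 = Ideal.span {LinearMap.det e} := by
  classical
  nontriviality R
  let b := Module.finBasis R F
  set g := Module.finrank R F
  let A : Matrix (Fin g) (Fin g) R := LinearMap.toMatrix b b e
  let x : Fin g → F ⧸ LinearMap.range e := fun l => (LinearMap.range e).mkQ (b l)
  have hx : Submodule.span R (Set.range x) = ⊤ := by
    have : Set.range x = (LinearMap.range e).mkQ '' Set.range b := by
      rw [← Set.range_comp]; rfl
    rw [this, Submodule.span_image, b.span_eq, Submodule.map_top, Submodule.range_mkQ]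
  have hP : ∀ t, ∑ l, Aᵀ t l • x l = 0 := fun t => by
    have h1 : ∑ l, Aᵀ t l • x l = (LinearMap.range e).mkQ (∑ l, A l t • b l) := by
      simp only [x, Matrix.transpose_apply, map_sum, map_smul]
    have h2 : ∑ l, A l t • b l = e (b t) := by
      rw [← Matrix.toLin_self b b A t, Matrix.toLin_toMatrix]
    rw [h1, h2, Submodule.mkQ_apply, Submodule.Quotient.mk_eq_zero]
    exact LinearMap.mem_range_self e (b t)
  have hgen : ∀ ρ : Fin g → R, ∑ l, ρ l • x l = 0 → ρ ∈ Submodule.span R (Set.range Aᵀ) := by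
    intro ρ hρ
    have h1 : ∑ l, ρ l • x l = (LinearMap.range e).mkQ (∑ l, ρ l • b l) := by
      simp only [x, map_sum, map_smul]
    rw [h1, Submodule.mkQ_apply, Submodule.Quotient.mk_eq_zero, LinearMap.mem_range] at hρ
    obtain ⟨v, hv⟩ := hρ
    have hcoord : ∀ l, ρ l = ∑ t, b.repr v t * Aᵀ t l := fun l => by
      have h2 := congr_arg (fun y => b.repr y l) hv
      simp only [b.repr_sum_self] at h2
      rw [← h2, ← LinearMap.toMatrix_mulVec_repr b b e v, Matrix.mulVec, dotProduct]
      simp only [Matrix.transpose_apply, mul_comm]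
      rfl
    have hρeq : ρ = ∑ t, b.repr v t • Aᵀ t := by
      ext l
      rw [hcoord l, Finset.sum_apply]
      simp only [Pi.smul_apply, smul_eq_mul]
    rw [hρeq]
    exact Submodule.sum_mem _ fun t _ =>
      Submodule.smul_mem _ _ (Submodule.subset_span ⟨t, rfl⟩)
  rw [Module.fittingIdeal_zero_eq_span_det_of_square_presentation x hx Aᵀ hP hgen,
    Matrix.det_transpose, LinearMap.det_toMatrix]

/-- `det e` kills `F/e(F)`: `det e • v ∈ e(F)` for every `v` (`Fitt₀ ⊆ Ann`, tree
de Smit–Rubin–Schoof Prop. 1.1 (i)). [cite: StacksProject, Tag 07ZA] -/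
theorem det_smul_mem_range (v : F) : LinearMap.det e • v ∈ LinearMap.range e := by
  have h : LinearMap.det e ∈ Module.annihilator R (F ⧸ LinearMap.range e) :=
    Module.fittingIdeal_zero_le_annihilator
      ((fittingIdeal_zero_quotient_range_eq_span_det e).symm ▸ Ideal.mem_span_singleton_self _)
  rw [Module.mem_annihilator] at h
  have := h (Submodule.Quotient.mk v)
  rwa [← Submodule.Quotient.mk_smul, Submodule.Quotient.mk_eq_zero] at this

/-- `F/e(F)` is a torsion module when `det e ≠ 0` (`R` a domain). [folklore] -/
theorem isTorsion_quotient_range [IsDomain R] (he : LinearMap.det e ≠ 0) :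
    Module.IsTorsion R (F ⧸ LinearMap.range e) := fun m => by
  obtain ⟨v, rfl⟩ := Submodule.mkQ_surjective _ m
  refine ⟨⟨LinearMap.det e, mem_nonZeroDivisors_of_ne_zero he⟩, ?_⟩
  rw [Submonoid.smul_def, ← map_smul, Submodule.mkQ_apply, Submodule.Quotient.mk_eq_zero]
  exact det_smul_mem_range e v

/-- **`char(F / e(F)) = (det e)`** for an endomorphism `e` with `det e ≠ 0` of a finite free
module over a Noetherian UFD (FILE 12: principal `Fitt₀` determines `char`).
[cite: SkinnerUrban2014, §3.1.6 (p. 20)] -/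
theorem charIdeal_quotient_range_eq_span_det [IsNoetherianRing R] [IsDomain R]
    [UniqueFactorizationMonoid R] (he : LinearMap.det e ≠ 0) :
    Module.charIdeal R (F ⧸ LinearMap.range e) = Ideal.span {LinearMap.det e} :=
  CharIdealSquarePresentation.charIdeal_eq_span_of_fittingIdeal_zero_eq_span
    (isTorsion_quotient_range e he) (fittingIdeal_zero_quotient_range_eq_span_det e)

end Coker

/-! ## §2. Restriction of scalars along a finite free extension: `char_R = (N_{S/R} det_S)` -/

section Restrict

variable {R : Type u} [CommRing R] {S : Type v} [CommRing S] [Algebra R S] [Module.Free R S]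
  [Module.Finite R S] {F : Type w} [AddCommGroup F] [Module R F] [Module S F]
  [IsScalarTower R S F] [Module.Free S F] [Module.Finite S F]

/-- **`char_R(F / e(F)) = (N_{S/R}(det_S e))`**: for an `S`-linear endomorphism `e` of a finite
free `S`-module with `det_S e ≠ 0`, `S` finite free over the Noetherian UFD `R`, the
characteristic ideal of the cokernel AS AN `R`-MODULE is generated by the norm of the
`S`-determinant (`det_R e = N_{S/R}(det_S e)`, Mathlib `LinearMap.det_restrictScalars`).
[cite: Washington1997, §13.2] -/
theorem charIdeal_quotient_range_restrictScalars [IsNoetherianRing R] [IsDomain R]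
    [UniqueFactorizationMonoid R] [IsDomain S] (e : F →ₗ[S] F) (he : LinearMap.det e ≠ 0) :
    Module.charIdeal R (F ⧸ LinearMap.range (e.restrictScalars R)) =
      Ideal.span {Algebra.norm R (LinearMap.det e)} := by
  haveI : Module.Free R F :=
    Module.Free.of_basis ((Module.Free.chooseBasis R S).smulTower (Module.Free.chooseBasis S F))
  haveI : Module.Finite R F := Module.Finite.trans S F
  rw [← LinearMap.det_restrictScalars]
  refine charIdeal_quotient_range_eq_span_det _ ?_
  rw [LinearMap.det_restrictScalars]
  exact Algebra.norm_ne_zero_iff.2 he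

/-- The cokernel `F/e(F)`, as an `R`-module, is torsion when `det_S e ≠ 0`. [folklore] -/
theorem isTorsion_quotient_range_restrictScalars [IsDomain R] [IsDomain S] (e : F →ₗ[S] F)
    (he : LinearMap.det e ≠ 0) :
    Module.IsTorsion R (F ⧸ LinearMap.range (e.restrictScalars R)) := by
  haveI : Module.Free R F :=
    Module.Free.of_basis ((Module.Free.chooseBasis R S).smulTower (Module.Free.chooseBasis S F))
  haveI : Module.Finite R F := Module.Finite.trans S F
  refine isTorsion_quotient_range _ ?_
  rw [LinearMap.det_restrictScalars]
  exact Algebra.norm_ne_zero_iff.2 he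

end Restrict

/-! ## §3. Transport along a semilinear bijection `ψ : C → X` over `σ : R →+* S` -/

section Semilinear

variable {R : Type u} [CommRing R] {S : Type v} [CommRing S] (σ : R →+* S)
  {C : Type w} [AddCommGroup C] [Module R C] {X : Type*} [AddCommGroup X] [Module S X]
  (ψ : C →ₛₗ[σ] X)

/-- **No finite submodules transport.** Let `ψ : C → X` be an injective `σ`-semilinear map, and
suppose `S` is generated by finitely many `s_i` as a module over `σ(R)`
(`x = ∑_i σ(a_i) s_i`). If `X` has no non-zero finite `S`-submodule, then `C` has no non-zero
finite `R`-submodule: the `S`-span of `ψ(N)` is `{∑_i s_i · ψ(y_i) : y_i ∈ N}`, a finite set.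
[folklore] -/
theorem eq_bot_of_finite_of_semilinear (hψ : Function.Injective ψ) {d : ℕ} (s : Fin d → S)
    (hs : ∀ x : S, ∃ a : Fin d → R, x = ∑ i, σ (a i) * s i)
    (hX : ∀ N : Submodule S X, Finite N → N = ⊥) (N : Submodule R C) (hN : Finite N) :
    N = ⊥ := by
  classical
  -- the finite `S`-submodule `{∑ s_i • ψ(y_i)}`
  let Θ : (Fin d → N) → X := fun y => ∑ i, s i • ψ (y i)
  have hΘadd : ∀ y y', Θ y + Θ y' = Θ (y + y') := fun y y' => by
    simp only [Θ, ← Finset.sum_add_distrib, Pi.add_apply, Submodule.coe_add, map_add, smul_add]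
  have hΘsmul : ∀ (x : S) (y : Fin d → N), ∃ y' : Fin d → N, x • Θ y = Θ y' := fun x y => by
    choose a ha using fun i => hs (x * s i)
    refine ⟨fun j => ∑ i, a i j • y i, ?_⟩
    simp only [Θ, Finset.smul_sum, Submodule.coe_sum, Submodule.coe_smul, map_sum,
      LinearMap.map_smulₛₗ]
    calc ∑ i, x • s i • ψ (y i) = ∑ i, ∑ j, s j • σ (a i j) • ψ (y i) := by
          refine Finset.sum_congr rfl fun i _ => ?_
          rw [← mul_smul, ha i, Finset.sum_smul]
          exact Finset.sum_congr rfl fun j _ => by rw [mul_comm, mul_smul]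
      _ = ∑ j, ∑ i, s j • σ (a i j) • ψ (y i) := Finset.sum_comm
  let N' : Submodule S X :=
    { carrier := Set.range Θ
      add_mem' := by rintro _ _ ⟨y, rfl⟩ ⟨y', rfl⟩; exact ⟨y + y', (hΘadd y y').symm⟩
      zero_mem' := ⟨0, by simp [Θ]⟩
      smul_mem' := by
        rintro x _ ⟨y, rfl⟩
        obtain ⟨y', hy'⟩ := hΘsmul x y
        exact ⟨y', hy'.symm⟩ }
  haveI : Finite N' := by
    have : Finite (Set.range Θ) := Set.finite_range Θ |>.to_subtype
    exact this
  have hN' := hX N' inferInstance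
  rw [eq_bot_iff]
  intro c hc
  rw [Submodule.mem_bot]
  apply hψ
  rw [map_zero]
  have hmem : ψ c ∈ N' := by
    obtain ⟨a, ha⟩ := hs 1
    refine ⟨fun i => a i • ⟨c, hc⟩, ?_⟩
    simp only [Θ, Submodule.coe_smul, LinearMap.map_smulₛₗ]
    calc ∑ i, s i • σ (a i) • ψ c = (∑ i, σ (a i) * s i) • ψ c := by
          rw [Finset.sum_smul]
          exact Finset.sum_congr rfl fun i _ => by rw [← mul_smul, mul_comm]
      _ = ψ c := by rw [← ha, one_smul]
  rw [hN'] at hmem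
  exact (Submodule.mem_bot S).1 hmem

/-- Every element of `σ(I)·X` is `ψ` of an element of `I·C`, for `ψ` surjective `σ`-semilinear.
[folklore] -/
theorem exists_mem_smul_top_apply_eq (hψ : Function.Surjective ψ) (I : Ideal R) {x : X}
    (hx : x ∈ I.map σ • (⊤ : Submodule S X)) :
    ∃ c ∈ I • (⊤ : Submodule R C), ψ c = x := by
  refine Submodule.smul_induction_on hx (fun j hj x hx' => ?_) ?_
  · -- induction over `j ∈ span (σ '' I)`, for all `x`
    clear hx'
    change j ∈ Submodule.span S (σ '' I) at hj
    induction hj using Submodule.span_induction generalizing x with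
    | mem j hj =>
      obtain ⟨a, ha, rfl⟩ := hj
      obtain ⟨c, rfl⟩ := hψ x
      exact ⟨a • c, Submodule.smul_mem_smul ha Submodule.mem_top, LinearMap.map_smulₛₗ ψ a c⟩
    | zero => exact ⟨0, Submodule.zero_mem _, by rw [map_zero, zero_smul]⟩
    | add j₁ j₂ _ _ h₁ h₂ =>
      obtain ⟨c₁, hc₁, h₁⟩ := h₁ x
      obtain ⟨c₂, hc₂, h₂⟩ := h₂ x
      exact ⟨c₁ + c₂, Submodule.add_mem _ hc₁ hc₂, by rw [map_add, h₁, h₂, add_smul]⟩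
    | smul t j _ hj =>
      obtain ⟨c, hc, h⟩ := hj (t • x)
      exact ⟨c, hc, by rw [h, smul_eq_mul, mul_smul, smul_comm]⟩
  · rintro x y ⟨c, hc, rfl⟩ ⟨c', hc', rfl⟩
    exact ⟨c + c', Submodule.add_mem _ hc hc', map_add ψ c c'⟩

/-- The composite `C → X → X/σ(I)X` has kernel `I·C` (for `ψ` bijective). [folklore] -/
theorem ker_mkQ_comp_eq (hψ : Function.Bijective ψ) (I : Ideal R) :
    LinearMap.ker (((I.map σ • (⊤ : Submodule S X)).mkQ).comp ψ) = I • (⊤ : Submodule R C) := by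
  refine le_antisymm ?_ ?_
  · intro c hc
    rw [LinearMap.mem_ker, LinearMap.comp_apply, Submodule.mkQ_apply,
      Submodule.Quotient.mk_eq_zero] at hc
    obtain ⟨c', hc', h⟩ := exists_mem_smul_top_apply_eq σ ψ hψ.2 I hc
    rwa [← hψ.1 h]
  · refine Submodule.smul_le.2 fun a ha c _ => ?_
    rw [LinearMap.mem_ker, LinearMap.comp_apply, LinearMap.map_smulₛₗ, Submodule.mkQ_apply,
      Submodule.Quotient.mk_eq_zero]
    exact Submodule.smul_mem_smul (Ideal.mem_map_of_mem σ ha) Submodule.mem_top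

/-- **Count transport: `#(C/IC) = #(X/σ(I)X)`** for a `σ`-semilinear bijection `ψ : C → X` and
any ideal `I ≤ R` (`ψ(IC) = σ(I)X`). [folklore] -/
theorem natCard_quotient_eq_of_semilinear (hψ : Function.Bijective ψ) (I : Ideal R) :
    Nat.card (C ⧸ I • (⊤ : Submodule R C)) =
      Nat.card (X ⧸ I.map σ • (⊤ : Submodule S X)) := by
  let q := ((I.map σ • (⊤ : Submodule S X)).mkQ).comp ψ
  have hker := ker_mkQ_comp_eq σ ψ hψ I
  let qbar := (I • (⊤ : Submodule R C)).liftQ q hker.ge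
  refine Nat.card_congr (Equiv.ofBijective qbar ⟨?_, ?_⟩)
  · rw [← LinearMap.ker_eq_bot]
    exact Submodule.ker_liftQ_eq_bot _ _ _ hker.le
  · intro y
    obtain ⟨x, rfl⟩ := Submodule.mkQ_surjective _ y
    obtain ⟨c, rfl⟩ := hψ.2 x
    exact ⟨Submodule.Quotient.mk c, rfl⟩

end Semilinear

end Summit.BirchSwinnertonDyer.Rank1Residual.X1.CharIdealRestrictScalars
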